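import Literature.MathematicalPhysics.QuantumFieldTheory.Balaban1983to89.B13Lemma3TorusPrimitivePoly

/-!
# Spine/NE5/TwoRunTorusPrimitiveParam — the two inputs of the torus chain (`hPhol`: holomorphy of the (2.14)-terms in a
# parameter; `h226`: (2.26) uniform in the parameter) FROM THE PRIMITIVE OBJECTS OF (2.14), for ANY complex parameter
# (NE5's two-run pencil `θ ∈ ball 0 (s∕r_j)`; (D4)'s background seam) (cell `pub-balaban-gaps`, seat `ne5` gen 8)

WHY.  On the papers' periodic carrier NE5 at one paired scale is, BY NAME, `TwoRunTorusRate.norm_E_sub_le_torus` ⇒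
`TwoRunTorusNE5.ne5_of_torus_rates(_all_scales)` ⇒ `T4OutputRate.NE5`, and the joint (seam, pencil) statement
`TwoRunTorusParam.differentiableOn_E_torus_param` serves row (D4).  Both consume exactly two inputs about a family of
(2.14)-TERM families `b ↦ P Z t φ b` over an open set `V` of a complex normed space `B`: `hPhol` (each `b ↦ P Z t φ b`
complex differentiable on `V`) and `h226` ((2.26) `‖P Z t φ b‖ ≤ weight L M c Z a t · e^{a₅|Z|}` UNIFORMLY in `b ∈ V`).
The cell's residual list (r7) of `HOME/ne/NE5.md` §13 reads them one layer down, at the PRIMITIVE objects of (2.14) —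
precision `A(σ) = C^{(k)}(Z₀,σ)⁻¹`, kernel `G(σ)` of `Γ_k(Z₀,σ)`, potentials `𝐕_k(Y,·)`, characteristic functions,
reference real operators `C`, `Γ₀` — with the located (2.16)–(2.23) letters of the tree's capstones.  THIS FILE closes
that layer for BOTH inputs and ANY parameter:
* §0 `differentiableOn_term214_param_polyτ` (generic): the term (2.14) is holomorphic in any complex parameter through
  its CORNER VALUES, with print's PER-DOMAIN τ-regions (poly-τ twin of
  `TwoRunTorusRateCauchy.differentiableOn_term214_param`, over `B13CauchyDecayPoly.term214_eq_DopC_polyτ`);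
* §1 `differentiableOn_core214_of_primitives_param` (generic, located index set `S`): the `X`-integral of (2.14) is
  `DifferentiableOn ℂ` on an open `V` of ANY complex normed space as soon as the primitives `A(p)`, `G(p)`, `𝐕(p)` are
  ENTRYWISE holomorphic on `V` and the located primitive letters (localisation, (2.16)-differences, (2.20) at `τ`, (2.22),
  (2.24)–(2.25)) hold UNIFORMLY on `V` — the parameter sibling of the σ-slot
  `B13Core214HolomorphicPrimitive.sepHolOn_core214_sigma_of_primitives` (H3) and of the τ-slot
  `B13Bound226LocatedPoly.sepHolOnPoly_core214_tau_of_primitives` (the capstone's five `_of_entrywise` lines →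
  `B13Core214Holomorphic.differentiableOn_core214X`, T11);
* §2 `hol_and_h226_torus_of_primitives_param` (torus model, per-domain τ-radii (2.18) as in
  `B13Lemma3TorusPrimitivePoly.h226_torus_of_primitives_holo_polyτ` (H7), ONE term `(Z, t)`, any `B`): for the term
  family READ FROM PRIMITIVES along the parameter, `b ↦ term214 r lZ lD (core214 (A b) (Γ b) (F214 |P| χ χᶜ 𝐃 (𝐕 b))) 0 0`,
  H7's hypotheses UNIFORM in `b ∈ V` plus entrywise `b`-holomorphy of `A b σ`, `G b σ`, `𝐕 b Y B` give BOTH `hPhol`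
  (§0 with σ-slot H3, τ-slot poly, parameter slot §1) AND `h226` (H7 at each `b`).
LEDGER MEANING (row NE5; (D4) NODE A reads the same with `b` = the background chart).  With `B = ℂ`, `V = ball 0 (s∕r_j)`
the two inputs of `norm_E_sub_le_torus` at scale `j` are theorems about NODE O's PER-RUN PRIMITIVE KERNEL FAMILIES
joined by a pencil staying in the located class on the disc (one layer below: T8–T13∕T18–T20, `r_j` = rows NE2∕NE3).
LOCATED TYPING POINT (x9) — WHICH VARIABLE CARRIES THE SMALL-FIELD CUT.  `χ_{k,Y₀}`, `χᶜ_{k,P}`, `𝐃`, `C`, `Γ₀`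
are COMMON to the family; only `A`, `G`, `𝐕` move with `b`.  This matches [II]: the decomposition (2.3) p. 12 and the
bound (2.22) p. 16 (large-field rate `r_P = ε₁∕g_k`; tree `B13Integral223`: `K = exp(−½γ₂ε₁²g_k⁻²|P| + …)`) put the
small-∕large-field thresholds on the GAUSSIAN variable `B` itself («g_k|B| < ε₁», (1.20) p. 6), which is background-
and run-independent (`g_k` is common to the paired runs) — so the cut is legitimately common to pencil and seam.
CAVEAT for a builder: [I] (2.9) p. 266 writes the cut in the minimiser-centred variable `B′ = (1∕i) log V′`, related
to `B` by the background-dependent map (1.19) `B′ = g_kCB − hD(g_kCB)` («C is the operator determined by the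
configuration V^{(k)}», [I] p. 268); typed literally, (2.9) would make χ background- and run-dependent and NOT
holomorphic along the parameter.  Print trades one cut for the other at the price of constants ((1.20); [I] p. 267
«with the constant ε₁ replaced by O(1)ε₁»); that trade belongs to the small-field bookkeeping, not to the
(2.14)-terms, and is outside this file.

HONEST FRAMING.  Plumbing + one generic holomorphy-under-the-integral lemma over LANDED shapes; every primitive family,
region, list and letter is a HYPOTHESIS; nothing of Bałaban's `C^{(k)}(Z₀,σ)`, `Γ_k(Z₀,σ)`, `𝐕_k` is constructed or
asserted; NE5 NOT PRINTED ∕ NOT PROVED; leaves 0∕12; (D4) 0∕1; spine 0∕9.  Rung (B)+1 on a FIXED finite T⁴ — NOT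
continuum, NOT infinite volume, NOT mass gap, NOT Clay.  HONEST DEPENDENCY: continuum YM on T⁴ ⇐ BetaPertH ∧ nine
spine estimates; BetaPertH ⇐ (D1) ∧ (D4) ∧ CAP+tail.  0 sorry, 0 `def`.

Sources: [II] = T. Bałaban, CMP **116** (1988) 1–22 [Balaban1988RG2Cluster] (1.19) p. 6, (2.14)–(2.15) p. 15,
(2.16)–(2.22) p. 16, (2.23)–(2.26) p. 17; [I] = CMP **109** (1987) [Balaban1987RG1] pp. 265, 268; C. King, CMP **102**
(1986) [King1986] p. 665; (2.3) p. 12 of [II].  Nothing here is a claim about the Yang–Mills mass gap.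
-/

noncomputable section

namespace Summit.QuantumFields.BalabanUV.T4Continuum.Spine.NE5.TwoRunTorusPrimitiveParam

open Matrix MeasureTheory Metric Set Finset
open Literature.MathematicalPhysics.QuantumFieldTheory.Balaban1983to89
open Literature.MathematicalPhysics.QuantumFieldTheory.Balaban1983to89.B13PerturbativeStep (WeightHyp)
open Literature.MathematicalPhysics.QuantumFieldTheory.Balaban1983to89.B13Term214 (core214 F214 SepHolOn term214 integrand214 cgaussMean cornerC DopC)
open Literature.MathematicalPhysics.QuantumFieldTheory.Balaban1983to89.B13Eq216FirstForm (hdef1_of_linear)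
open Literature.MathematicalPhysics.QuantumFieldTheory.Balaban1983to89.B13Bound226Primitive (hdef3_of_linear h216R3_of_diff continuous_of_linear)
open Literature.MathematicalPhysics.QuantumFieldTheory.Balaban1983to89.B13Bound226Located (h216R1_of_factors hR1_of_entrywise hR2_of_entrywise
  hR3_of_entrywise h17a_of_entrywise h17b_of_entrywise entry_bound_mono_rate kc_l1_nonneg)
open Literature.MathematicalPhysics.QuantumFieldTheory.Balaban1983to89.B13Integral223 (norm_F214_le)
open Literature.MathematicalPhysics.QuantumFieldTheory.Balaban1983to89.B13Core214Holomorphic (measurable_F214 differentiableOn_core214X)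
open Literature.MathematicalPhysics.QuantumFieldTheory.Balaban1983to89.B13Core214HolomorphicPrimitive (sepHolOn_core214_sigma_of_primitives)
open Literature.MathematicalPhysics.QuantumFieldTheory.Balaban1983to89.B13Bound226LocatedPoly (sepHolOnPoly_core214_tau_of_primitives)
open Literature.MathematicalPhysics.QuantumFieldTheory.Balaban1983to89.B13CauchyDecay (closedBall_subset_closedBall_of_mem_uIcc)
open Literature.MathematicalPhysics.QuantumFieldTheory.Balaban1983to89.B13CauchyDecayPoly (SepHolOnPoly term214_eq_DopC_polyτ)
open Literature.MathematicalPhysics.QuantumFieldTheory.Balaban1983to89.B13Lemma3TorusPrimitive (weightHyp_tdist1 tdist1_symm kc_tdist1)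
open Literature.MathematicalPhysics.QuantumFieldTheory.Balaban1983to89.B13Lemma3TorusPrimitivePoly (h226_torus_of_primitives_holo_polyτ)
open Literature.MathematicalPhysics.QuantumFieldTheory.Balaban1983to89.TreeLengthTorus (TPt TDom tsys)
open Literature.MathematicalPhysics.QuantumFieldTheory.Balaban1983to89.TreeLengthTorusTransfer (tclosure)
open Literature.MathematicalPhysics.QuantumFieldTheory.Balaban1983to89.B13Lemma3TorusData (TBond)
open Literature.MathematicalPhysics.QuantumFieldTheory.Balaban1983to89.B13Lemma3TorusTerms (weight Z0)
open Literature.MathematicalPhysics.QuantumFieldTheory.Balaban1983to89.B13Bound143 (invTau)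
open Literature.MathematicalPhysics.QuantumFieldTheory.Balaban1983to89.B5TorusCover (UT)
open Literature.MathematicalPhysics.QuantumFieldTheory.Balaban1983to89.B9Thm37GlueTorus (tdist1)

/-! ## §0. The generic term (2.14) is holomorphic in any complex parameter through its corner values (poly τ-regions) -/

section Corner

variable {E : Type*} [NormedAddCommGroup E] [NormedSpace ℂ E] [CompleteSpace E]
variable {ι : Type*} [DecidableEq ι] {κ : Type*} [DecidableEq κ]
variable {B : Type*} [NormedAddCommGroup B] [NormedSpace ℂ B]

/-- Corners of `{0,1}^S` over a base point with coordinates in regions `U j ∋ 0, 1` have coordinates in the regions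
(plumbing; the statement of the private lemmas of `B13CauchyDecay(Poly)`).
[cite: Balaban1988RG2Cluster, (2.14) p.15] (elementary API for (2.14)) -/
private theorem cornerC_mem_poly' {U : ι → Set ℂ} (h0 : ∀ j, (0 : ℂ) ∈ U j) (h1 : ∀ j, (1 : ℂ) ∈ U j)
    (S T : Finset ι) {p : ι → ℂ} (hp : ∀ j, p j ∈ U j) (j : ι) : cornerC S T p j ∈ U j := by
  unfold cornerC
  split_ifs
  · exact h1 j
  · exact h0 j
  · exact hp j

/-- **THE GENERIC TERM (2.14) IS HOLOMORPHIC IN ANY COMPLEX PARAMETER THROUGH ITS CORNER VALUES, PER-DOMAIN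
τ-REGIONS.**  For a family `b ↦ Ψ b` (`b` in a set `V` of a complex normed space) whose members are separately
holomorphic in the `σ` on an open `Uσ` (for `τ` of the regions) and of the poly class `SepHolOnPoly Uτ` in the `τ`
(for `σ` of `Uσ`) — `Uσ` and every `Uτ Y` containing the closed `r`-discs about `[0, 1]` — and whose CORNER VALUES
`b ↦ Ψ b σ τ` are complex differentiable on `V` for all admissible `(σ, τ)`: `b ↦ term214 r lZ lD (Ψ b) σ₀ τ₀` is
complex differentiable on `V` (on `V` it IS the finite signed double difference of corner values,
`B13CauchyDecayPoly.term214_eq_DopC_polyτ`).  The poly-τ twin of `TwoRunTorusRateCauchy.differentiableOn_term214_param`;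
no joint analyticity in `(b, σ, τ)` is needed. [cite: Balaban1988RG2Cluster, (2.14) p.15, (2.18) p.16] -/
theorem differentiableOn_term214_param_polyτ {Uσ : Set ℂ} {Uτ : κ → Set ℂ} (hUσ : IsOpen Uσ)
    (hUτ : ∀ Y, IsOpen (Uτ Y)) {r : ℝ} (hr : 0 < r)
    (hsubσ : ∀ s ∈ Set.uIcc (0 : ℝ) 1, closedBall (s : ℂ) r ⊆ Uσ)
    (hsubτ : ∀ Y, ∀ s ∈ Set.uIcc (0 : ℝ) 1, closedBall (s : ℂ) r ⊆ Uτ Y) {V : Set B}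
    {Ψ : B → (ι → ℂ) → (κ → ℂ) → E}
    (hΨσ : ∀ b ∈ V, ∀ τ : κ → ℂ, (∀ j, τ j ∈ Uτ j) → SepHolOn Uσ (fun σ => Ψ b σ τ))
    (hΨτ : ∀ b ∈ V, ∀ σ : ι → ℂ, (∀ j, σ j ∈ Uσ) → SepHolOnPoly Uτ (fun τ => Ψ b σ τ))
    (hpt : ∀ (σ : ι → ℂ) (τ : κ → ℂ), (∀ j, σ j ∈ Uσ) → (∀ j, τ j ∈ Uτ j) →
      DifferentiableOn ℂ (fun b => Ψ b σ τ) V)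
    {lZ : List ι} (hlZ : lZ.Nodup) {lD : List κ} (hlD : lD.Nodup) {σ₀ : ι → ℂ} (hσ₀ : ∀ j, σ₀ j ∈ Uσ)
    {τ₀ : κ → ℂ} (hτ₀ : ∀ j, τ₀ j ∈ Uτ j) :
    DifferentiableOn ℂ (fun b => term214 r lZ lD (Ψ b) σ₀ τ₀) V := by
  have h0σ : (0 : ℂ) ∈ Uσ := by simpa using hsubσ 0 (by simp) (mem_closedBall_self hr.le)
  have h1σ : (1 : ℂ) ∈ Uσ := by simpa using hsubσ 1 (by simp) (mem_closedBall_self hr.le)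
  have h0τ : ∀ Y, (0 : ℂ) ∈ Uτ Y := fun Y => by simpa using hsubτ Y 0 (by simp) (mem_closedBall_self hr.le)
  have h1τ : ∀ Y, (1 : ℂ) ∈ Uτ Y := fun Y => by simpa using hsubτ Y 1 (by simp) (mem_closedBall_self hr.le)
  have heq : ∀ b ∈ V, term214 r lZ lD (Ψ b) σ₀ τ₀ =
      DopC lZ.toFinset (fun σ => DopC lD.toFinset (fun τ => Ψ b σ τ) τ₀) σ₀ := fun b hb =>
    term214_eq_DopC_polyτ hUσ hUτ hr hsubσ hsubτ (hΨσ b hb) (hΨτ b hb) hlZ hlD hσ₀ hτ₀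
  have hD : DifferentiableOn ℂ
      (fun b => DopC lZ.toFinset (fun σ => DopC lD.toFinset (fun τ => Ψ b σ τ) τ₀) σ₀) V := by
    have key : (fun b => DopC lZ.toFinset (fun σ => DopC lD.toFinset (fun τ => Ψ b σ τ) τ₀) σ₀)
        = fun b => ∑ T ∈ lZ.toFinset.powerset, ((-1 : ℂ) ^ (lZ.toFinset \ T).card) •
            ∑ T' ∈ lD.toFinset.powerset, ((-1 : ℂ) ^ (lD.toFinset \ T').card) •
              Ψ b (cornerC lZ.toFinset T σ₀) (cornerC lD.toFinset T' τ₀) := rfl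
    rw [key]
    refine DifferentiableOn.fun_sum fun T _ => DifferentiableOn.const_smul ?_ _
    refine DifferentiableOn.fun_sum fun T' _ => DifferentiableOn.const_smul ?_ _
    exact hpt _ _ (cornerC_mem_poly' (U := fun _ => Uσ) (fun _ => h0σ) (fun _ => h1σ) _ T hσ₀)
      (cornerC_mem_poly' h0τ h1τ _ T' hτ₀)
  exact hD.congr heq

end Corner

/-! ## §1. The `X`-integral of (2.14) is holomorphic in ANY complex parameter of the primitive objects -/

section Param

variable {S : Type*} [DecidableEq S] {ρd : S → S → ℝ} {Kc : ℝ → ℝ}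
variable {Λ : Type} [Fintype Λ] [DecidableEq Λ] {C₀ : Type} [Fintype C₀] [DecidableEq C₀] {κ : Type*}
variable {P : Type*} [NormedAddCommGroup P] [NormedSpace ℂ P]

/-- **THE PARAMETER SLOT FROM THE PRIMITIVE OBJECTS.**  Located index set `S` (weight `ρ`, lattice constant `Kc`),
bonds of `Z₀` (`Λ`) and of `Z` (`Λ ⊕ C₀`) located with `≤ m` per site, an OPEN set `V` of a complex normed space `P`;
along `p ∈ V`: `A(p)` symmetric with `Re A(p) ≻ 0` and ENTRYWISE HOLOMORPHIC, `Γ(p)` LINEAR with an entrywise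
holomorphic kernel `G(p)`, potentials `𝐕(p, Y, ·)` holomorphic in `p` at every field and measurable, the localisation
letters `K_G, K_Γ, K_{Cσ}, K₀`, the (2.16)-differences `θ_Γ, θ_C, θ_E` against the REAL reference `C`, `Γ₀`, (2.20) at
the given `τ`, (2.22) — all UNIFORM on `V` — and the (2.24)–(2.25) smallness.  Conclusion: `p ↦ ∫dμ₀(X)|_Z (lines 2–4
of (2.14))` = `cgaussMean 1 (integrand214 (A p) (Γ p) (F214 |P| χ χᶜ 𝐃 (𝐕 p) τ))` is `DifferentiableOn ℂ` on `V` (the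
five `_of_entrywise` lines of `B13Bound226Located` pointwise in `p`, then `B13Core214Holomorphic.differentiableOn_core214X`).
[cite: Balaban1988RG2Cluster, (2.14)–(2.15) p.15, (2.16)–(2.22) p.16, (2.23)–(2.25) p.17] -/
theorem differentiableOn_core214_of_primitives_param (hρ : WeightHyp 0 ρd) (hρs : ∀ x y : S, ρd x y = ρd y x)
    (hKc : ∀ b : ℝ, 0 < b → ∀ (T : Finset S) (x : S), ∑ y ∈ T, Real.exp (-(b * ρd x y)) ≤ Kc b)
    (hKc0 : ∀ b : ℝ, 0 < b → 0 ≤ Kc b)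
    {V : Set P} (hV : IsOpen V)
    (A : P → Matrix Λ Λ ℂ) (Γ : P → (Λ ⊕ C₀ → ℝ) → (Λ → ℂ)) (G : P → Matrix Λ (Λ ⊕ C₀) ℂ)
    (hAhol : ∀ i j, DifferentiableOn ℂ (fun p => A p i j) V)
    (hGhol : ∀ i j, DifferentiableOn ℂ (fun p => G p i j) V)
    (hAs : ∀ p ∈ V, (A p).IsSymm) (hA : ∀ p ∈ V, ((A p).map Complex.re).PosDef)
    (hlin : ∀ p ∈ V, ∀ X : Λ ⊕ C₀ → ℝ, Γ p X = G p *ᵥ fun j => (X j : ℂ))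
    -- the last line: characteristic functions and 𝐃 fixed, potentials moving with `p`, at a fixed `τ`
    (cardP : ℕ) {χY₀ χcP : (Λ → ℝ) → ℝ} (hχm : Measurable χY₀) (hχcm : Measurable χcP)
    (hχ0 : ∀ B, 0 ≤ χY₀ B) (hχc0 : ∀ B, 0 ≤ χcP B) (Dfam : Finset κ)
    (Vk : P → κ → (Λ → ℝ) → ℂ) (hVhol : ∀ Y B, DifferentiableOn ℂ (fun p => Vk p Y B) V)
    (hVm : ∀ p ∈ V, ∀ Y, Measurable (Vk p Y)) (τ : κ → ℂ)
    {γ₂ rP a w : ℝ} (qP : (Λ → ℝ) → ℝ)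
    (h222 : ∀ B, χY₀ B * χcP B ≤ Real.exp (-(γ₂ / 2 * rP ^ 2 * cardP) + γ₂ / 2 * qP B)) (hγ₂ : 0 ≤ γ₂)
    (hqP : ∀ B, qP B ≤ B ⬝ᵥ B) (ha0 : 0 ≤ a)
    (h220 : ∀ p ∈ V, ∀ B, ∑ Y ∈ Dfam, ‖τ Y‖ * ‖Vk p Y B‖ ≤ a / 2 * (B ⬝ᵥ B) + w)
    {C : Matrix Λ Λ ℝ} (hC : C.PosDef) (Γ₀ : Matrix Λ (Λ ⊕ C₀) ℝ)
    (locΛ : Λ → S) (locN : Λ ⊕ C₀ → S) {m : ℕ}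
    (hfibΛ : ∀ x : S, (Finset.univ.filter fun i => locΛ i = x).card ≤ m)
    (hfibN : ∀ x : S, (Finset.univ.filter fun j => locN j = x).card ≤ m)
    {kap kap' kap'' θ θE θΓ θC KG KΓ KCs K₀ : ℝ} (hkap'' : 0 < kap'') (h1 : kap'' < kap') (h2 : kap' < kap)
    (hθE : 0 ≤ θE) (hθΓ : 0 ≤ θΓ) (hθC : 0 ≤ θC) (hKG : 0 ≤ KG) (hKΓ : 0 ≤ KΓ) (hKCs : 0 ≤ KCs) (hK₀ : 0 ≤ K₀)
    (hθEle : θE ≤ θ) (hθΓle : θΓ ≤ θ)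
    (hθR1le : (m * Kc (kap - kap')) * (m * Kc (kap' - kap''))
      * (θΓ * KCs * KG + KΓ * θC * KG + KΓ * K₀ * θΓ) ≤ θ)
    (hG : ∀ p ∈ V, ∀ b j, ‖G p b j‖ ≤ KG * Real.exp (-(kap * ρd (locΛ b) (locN j))))
    (hΓ₀ : ∀ b j, ‖Γ₀ b j‖ ≤ KΓ * Real.exp (-(kap * ρd (locΛ b) (locN j))))
    (hCs : ∀ p ∈ V, ∀ b b', ‖(A p)⁻¹ b b'‖ ≤ KCs * Real.exp (-(kap * ρd (locΛ b) (locΛ b'))))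
    (hC216 : ∀ b b', ‖C b b'‖ ≤ K₀ * Real.exp (-(kap * ρd (locΛ b) (locΛ b'))))
    (hdΓ : ∀ p ∈ V, ∀ b j, ‖(G p - Γ₀.map (algebraMap ℝ ℂ)) b j‖ ≤ θΓ * Real.exp (-(kap * ρd (locΛ b) (locN j))))
    (hdC : ∀ p ∈ V, ∀ b b',
      ‖((A p)⁻¹ - C.map (algebraMap ℝ ℂ)) b b'‖ ≤ θC * Real.exp (-(kap * ρd (locΛ b) (locΛ b'))))
    (hdE : ∀ p ∈ V, ∀ b b',
      ‖(A p - C⁻¹.map (algebraMap ℝ ℂ)) b b'‖ ≤ θE * Real.exp (-(kap * ρd (locΛ b) (locΛ b'))))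
    (hsmallKθ : K₀ * (m * Kc kap) * (θ * (m * Kc kap'')) < 1)
    {c g : ℝ} (hc0 : 0 ≤ c) (hc : ∀ k, hC.1.eigenvalues k ≤ c)
    (hαc : (2 * (θ * (m * Kc kap'')) + (γ₂ + a)) * c ≤ 1 / 2)
    (hΓq : ∀ X : Λ ⊕ C₀ → ℝ, (Γ₀ *ᵥ X) ⬝ᵥ (C *ᵥ (Γ₀ *ᵥ X)) ≤ g * (X ⬝ᵥ X))
    (hsmall : (2 * (θ * (m * Kc kap'')) + (γ₂ + a)) * (1 + 2 * c * g) ≤ 1 / 2) :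
    DifferentiableOn ℂ (fun p => cgaussMean (1 : Matrix (Λ ⊕ C₀) (Λ ⊕ C₀) ℂ)
      (integrand214 (A p) (Γ p) (F214 cardP χY₀ χcP Dfam (Vk p) τ))) V := by
  have hθ : 0 ≤ θ := hθE.trans hθEle
  have hkap : 0 < kap := hkap''.trans (h1.trans h2)
  have hkk : kap'' ≤ kap := (h1.trans h2).le
  have hρ0 : 0 ≤ θ * (m * Kc kap'') := mul_nonneg hθ (mul_nonneg (Nat.cast_nonneg m) (hKc0 _ hkap''))
  have h216R1 : ∀ p ∈ V, ∀ b b',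
      ‖(Γ₀ᵀ * C * Γ₀ - ((G p)ᵀ * (A p)⁻¹ * G p).map Complex.re) b b'‖
        ≤ θ * Real.exp (-(kap'' * ρd (locN b) (locN b'))) := fun p hp b b' =>
    (h216R1_of_factors hρ hρs hKc hKc0 hθΓ hθC hKG hKΓ hKCs hK₀ hkap''.le h1 h2 locΛ locN hfibΛ
      (hdΓ p hp) (hdC p hp) (hG p hp) hΓ₀ (hCs p hp) hC216 b b').trans
      (mul_le_mul_of_nonneg_right hθR1le (Real.exp_pos _).le)
  have h216E : ∀ p ∈ V, ∀ b b',
      ‖(A p - C⁻¹.map (algebraMap ℝ ℂ)) b b'‖ ≤ θ * Real.exp (-(kap'' * ρd (locΛ b) (locΛ b'))) :=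
    fun p hp b b' => (entry_bound_mono_rate hρ hθE hkk locΛ locΛ (hdE p hp) b b').trans
      (mul_le_mul_of_nonneg_right hθEle (Real.exp_pos _).le)
  have h216R3 : ∀ p ∈ V, ∀ i j,
      ‖((G p).map Complex.re - Γ₀) i j‖ ≤ θ * Real.exp (-(kap'' * ρd (locΛ i) (locN j))) := by
    intro p hp
    have hmono : ∀ i j, ‖(G p - Γ₀.map (algebraMap ℝ ℂ)) i j‖ ≤ θ * Real.exp (-(kap'' * ρd (locΛ i) (locN j))) :=
      fun i j => (entry_bound_mono_rate hρ hθΓ hkk locΛ locN (hdΓ p hp) i j).trans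
        (mul_le_mul_of_nonneg_right hθΓle (Real.exp_pos _).le)
    exact fun i j => h216R3_of_diff hmono i j
  have hΓd : ∀ (X : Λ ⊕ C₀ → ℝ) (i : Λ), DifferentiableOn ℂ (fun p => Γ p X i) V := by
    intro X i
    have e : ∀ p ∈ V, Γ p X i = ∑ j, G p i j * (X j : ℂ) := fun p hp => by
      rw [hlin p hp X]; rfl
    exact (DifferentiableOn.fun_sum fun j _ => (hGhol i j).mul (differentiableOn_const _)).congr e
  have hFd : ∀ B, DifferentiableOn ℂ (fun p => F214 cardP χY₀ χcP Dfam (Vk p) τ B) V := by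
    intro B
    unfold F214
    have h : DifferentiableOn ℂ (fun p => ∑ Y ∈ Dfam, τ Y * Vk p Y B) V :=
      DifferentiableOn.fun_sum fun Y _ => (differentiableOn_const (τ Y)).mul (hVhol Y B)
    exact (differentiableOn_const ((-1 : ℂ) ^ cardP * (χY₀ B : ℂ) * (χcP B : ℂ))).mul h.cexp
  refine differentiableOn_core214X (Γ₀ := Γ₀) (ρ := θ * (m * Kc kap''))
    (η := K₀ * (m * Kc kap) * (θ * (m * Kc kap'')) * (1 + (1 - K₀ * (m * Kc kap) * (θ * (m * Kc kap'')))⁻¹) / 2)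
    (K := Real.exp (-(γ₂ / 2 * rP ^ 2 * cardP) + w)) (a := γ₂ + a) (g := g)
    hV hAhol hAs hA hΓd (fun p hp => continuous_of_linear (G p) (Γ p) (hlin p hp)) hFd
    (fun p hp => (measurable_F214 cardP hχm hχcm Dfam (hVm p hp) τ).stronglyMeasurable) hC hρ0 (by positivity)
    (Real.exp_pos _).le (fun p hp X => ?_) (fun p hp => ?_) (fun p hp => ?_) (fun p hp B => ?_)
    (fun p hp X B => ?_) (fun p hp B => ?_) hc0 hc hαc hΓq (lt_of_le_of_lt hsmall (by norm_num))
  · exact hR1_of_entrywise hρ hρs hKc (Γ p) Γ₀ _ hθ hkap'' locN hfibN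
      (hdef1_of_linear (A p) (G p) (Γ p) (hlin p hp) C Γ₀) (h216R1 p hp) X
  · exact h17a_of_entrywise hρ hρs hKc hC (hA p hp) hθ hkap'' hK₀ hkap locΛ hfibΛ hC216 (h216E p hp) hsmallKθ
  · exact h17b_of_entrywise hρ hρs hKc hC (hA p hp) hθ hkap'' hK₀ hkap locΛ hfibΛ hC216 (h216E p hp) hsmallKθ
  · exact hR2_of_entrywise hρ hρs hKc hθ hkap'' locΛ hfibΛ (h216E p hp) B
  · exact hR3_of_entrywise hρs hKc (Γ p) Γ₀ _ hθ hkap'' locΛ locN hfibΛ hfibN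
      (hdef3_of_linear (G p) (Γ p) (hlin p hp) Γ₀) (h216R3 p hp) X B
  · exact norm_F214_le cardP χY₀ χcP Dfam (Vk p) τ qP B (hχ0 B) (hχc0 B) (h222 B) hγ₂ (hqP B) (h220 p hp B)

end Param

/-! ## §2. The torus model: both inputs of the torus chain from the primitive objects, any parameter -/

section Torus

variable {d L N' : ℕ} [NeZero L] [NeZero N'] {M : ℕ}
variable {ν : ℕ} {Nf : Fin ν → ℕ} [∀ i, NeZero (Nf i)]
variable {Λ : Type} [Fintype Λ] [DecidableEq Λ] {C₀ : Type} [Fintype C₀] [DecidableEq C₀]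
variable {B : Type*} [NormedAddCommGroup B] [NormedSpace ℂ B]

open Classical in
/-- **`hPhol` AND `h226` FOR ONE TERM OF THE TORUS MODEL, FROM THE PRIMITIVE OBJECTS ALONG ANY PARAMETER.**  A term
`(Z, t)` of the torus model (lists `lZ` over the blocks of `Z∖Z′₀`, `lD` over `𝐃`; contour radius `r`), the σ-region
`Uσ ⊇ {|σ| ≤ e^{κ₁}}`, PER-DOMAIN τ-regions `Uτ Y ⊇ {|z| ≤ |τ(Y)|}` (radii (2.18)), an open `V` of a complex normed
space `B`, and along `b ∈ V` the (2.14)-data READ FROM PRIMITIVES — `A b σ`, `Γ b σ` linear with kernel `G b σ`,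
potentials `𝐕 b Y` — with `χ`, `χᶜ`, `𝐃`, `C`, `Γ₀` common to the family (located typing point (x9)).  Hypotheses: those
of `B13Lemma3TorusPrimitivePoly.h226_torus_of_primitives_holo_polyτ` for EVERY `b ∈ V` with ONE package of letters, plus
entrywise holomorphy IN `b` of `A b σ`, `G b σ` (each `σ` of the open σ-polydisc) and of `𝐕 b Y B`.  Conclusion: (1)
`b ↦ term214 r lZ lD (core214 (A b) (Γ b) (F214 |P| χ χᶜ 𝐃 (𝐕 b))) 0 0` is `DifferentiableOn ℂ` on `V` — the input `hPhol`
of `TwoRunTorusRate.norm_E_sub_le_torus` (`B = ℂ`, `V = ball 0 ρ`) ∕ `TwoRunTorusParam.differentiableOn_E_torus_param`;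
(2) (2.26) for every `b ∈ V` — their input `h226`.
[cite: Balaban1988RG2Cluster, (2.14)–(2.15) p.15, (2.16)–(2.22) p.16, (2.23)–(2.26) p.17; King1986, p.665] -/
theorem hol_and_h226_torus_of_primitives_param (c : B13.Consts) (hκ₁ : 1 ≤ c.κ₁) (hα₆ : c.α₆ ≠ 0)
    (Z : TDom d N') (t : Finset (TDom d (L * N')) × Finset (TBond d M (L * N')))
    (hpos : ∀ Y : TDom d (L * N'), 0 < invTau c ((tsys d (L * N')).dj Y))
    (hhalf : ∀ Y : TDom d (L * N'), invTau c ((tsys d (L * N')).dj Y) ≤ 1 / 2)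
    {Uσ : Set ℂ} {Uτ : TDom d (L * N') → Set ℂ} (hUσ : IsOpen Uσ) (hUτ : ∀ Y, IsOpen (Uτ Y))
    (hUexp : closedBall (0 : ℂ) (Real.exp c.κ₁) ⊆ Uσ)
    (hUtau : ∀ Y : TDom d (L * N'), closedBall (0 : ℂ) ((invTau c ((tsys d (L * N')).dj Y))⁻¹) ⊆ Uτ Y)
    {r : ℝ} (hr : 0 < r) (hr' : r ≤ Real.exp c.κ₁ - 1)
    (hsubτ : ∀ Y, ∀ s ∈ Set.uIcc (0 : ℝ) 1, closedBall (s : ℂ) r ⊆ Uτ Y)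
    (lZ : List (TPt d N')) (hlZ : lZ.Nodup ∧ lZ.toFinset = Z.1 \ tclosure L N' (Z0 M t))
    (lD : List (TDom d (L * N'))) (hlD : lD.Nodup ∧ lD.toFinset = t.1)
    {V : Set B} (hV : IsOpen V)
    (A : B → (TPt d N' → ℂ) → Matrix Λ Λ ℂ) (Γ : B → (TPt d N' → ℂ) → (Λ ⊕ C₀ → ℝ) → (Λ → ℂ))
    (G : B → (TPt d N' → ℂ) → Matrix Λ (Λ ⊕ C₀) ℂ)
    (χY₀ χcP : (Λ → ℝ) → ℝ) (hχ0 : ∀ Bf, 0 ≤ χY₀ Bf) (hχc0 : ∀ Bf, 0 ≤ χcP Bf) (Dfam : Finset (TDom d (L * N')))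
    (Vk : B → TDom d (L * N') → (Λ → ℝ) → ℂ)
    {C : Matrix Λ Λ ℝ} (hC : C.PosDef) (Γ₀ : Matrix Λ (Λ ⊕ C₀) ℝ)
    -- regularity: entrywise holomorphy in σ at each `b ∈ V`, and IN `b` at each σ of the open σ-polydisc; measurability
    (hAhol : ∀ b ∈ V, ∀ i j, DifferentiableOn ℂ (fun σ => A b σ i j) {σ | ∀ j, σ j ∈ Uσ})
    (hGhol : ∀ b ∈ V, ∀ i j, DifferentiableOn ℂ (fun σ => G b σ i j) {σ | ∀ j, σ j ∈ Uσ})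
    (hAholb : ∀ σ : TPt d N' → ℂ, (∀ j, σ j ∈ Uσ) → ∀ i j, DifferentiableOn ℂ (fun b => A b σ i j) V)
    (hGholb : ∀ σ : TPt d N' → ℂ, (∀ j, σ j ∈ Uσ) → ∀ i j, DifferentiableOn ℂ (fun b => G b σ i j) V)
    (hVholb : ∀ Y Bf, DifferentiableOn ℂ (fun b => Vk b Y Bf) V)
    (hχm : Measurable χY₀) (hχcm : Measurable χcP) (hVm : ∀ b ∈ V, ∀ Y, Measurable (Vk b Y))
    (hAs : ∀ b ∈ V, ∀ σ : TPt d N' → ℂ, (∀ j, σ j ∈ Uσ) → (A b σ).IsSymm)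
    (hA : ∀ b ∈ V, ∀ σ : TPt d N' → ℂ, (∀ j, σ j ∈ Uσ) → ((A b σ).map Complex.re).PosDef)
    (hlin : ∀ b ∈ V, ∀ σ : TPt d N' → ℂ, (∀ j, σ j ∈ Uσ) →
      ∀ X : Λ ⊕ C₀ → ℝ, Γ b σ X = G b σ *ᵥ fun j => (X j : ℂ))
    -- the (2.22) shape, and (2.20) on the open PER-DOMAIN τ-region, uniform in `b`
    {γ₂ rP a₂₀ w : ℝ} (qP : (Λ → ℝ) → ℝ)
    (h222 : ∀ Bf, χY₀ Bf * χcP Bf ≤ Real.exp (-(γ₂ / 2 * rP ^ 2 * (t.2.card : ℕ)) + γ₂ / 2 * qP Bf))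
    (hγ₂ : 0 ≤ γ₂) (hqP : ∀ Bf, qP Bf ≤ Bf ⬝ᵥ Bf) (ha0 : 0 ≤ a₂₀)
    (h220U : ∀ b ∈ V, ∀ τ : TDom d (L * N') → ℂ, (∀ Y, τ Y ∈ Uτ Y) →
      ∀ Bf, ∑ Y ∈ Dfam, ‖τ Y‖ * ‖Vk b Y Bf‖ ≤ a₂₀ / 2 * (Bf ⬝ᵥ Bf) + w)
    (locΛ : Λ → UT Nf) (locN : Λ ⊕ C₀ → UT Nf) {m : ℕ}
    (hfibΛ : ∀ x : UT Nf, (Finset.univ.filter fun i => locΛ i = x).card ≤ m)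
    (hfibN : ∀ x : UT Nf, (Finset.univ.filter fun j => locN j = x).card ≤ m)
    {kap kap' kap'' θ θE θΓ θC KG KΓ KCs K₀ : ℝ} (hkap'' : 0 < kap'') (h1 : kap'' < kap') (h2 : kap' < kap)
    (hθE : 0 ≤ θE) (hθΓ : 0 ≤ θΓ) (hθC : 0 ≤ θC) (hKG : 0 ≤ KG) (hKΓ : 0 ≤ KΓ) (hKCs : 0 ≤ KCs) (hK₀ : 0 ≤ K₀)
    (hθEle : θE ≤ θ) (hθΓle : θΓ ≤ θ)
    (hθR1le : (m * (1 + 2 / (kap - kap')) ^ ν) * (m * (1 + 2 / (kap' - kap'')) ^ ν)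
      * (θΓ * KCs * KG + KΓ * θC * KG + KΓ * K₀ * θΓ) ≤ θ)
    -- localisation of the primitive kernels in the torus distance, uniform in `b` and σ (L17a)
    (hG : ∀ b ∈ V, ∀ σ : TPt d N' → ℂ, (∀ j, σ j ∈ Uσ) →
      ∀ i j, ‖G b σ i j‖ ≤ KG * Real.exp (-(kap * tdist1 Nf (locΛ i) (locN j))))
    (hΓ₀ : ∀ i j, ‖Γ₀ i j‖ ≤ KΓ * Real.exp (-(kap * tdist1 Nf (locΛ i) (locN j))))
    (hCs : ∀ b ∈ V, ∀ σ : TPt d N' → ℂ, (∀ j, σ j ∈ Uσ) →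
      ∀ i i', ‖(A b σ)⁻¹ i i'‖ ≤ KCs * Real.exp (-(kap * tdist1 Nf (locΛ i) (locΛ i'))))
    (hC216 : ∀ i i', ‖C i i'‖ ≤ K₀ * Real.exp (-(kap * tdist1 Nf (locΛ i) (locΛ i'))))
    -- the (2.16)-type differences against the reference operators, uniform in `b` and σ (L16a)
    (hdΓ : ∀ b ∈ V, ∀ σ : TPt d N' → ℂ, (∀ j, σ j ∈ Uσ) →
      ∀ i j, ‖(G b σ - Γ₀.map (algebraMap ℝ ℂ)) i j‖ ≤ θΓ * Real.exp (-(kap * tdist1 Nf (locΛ i) (locN j))))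
    (hdC : ∀ b ∈ V, ∀ σ : TPt d N' → ℂ, (∀ j, σ j ∈ Uσ) →
      ∀ i i', ‖((A b σ)⁻¹ - C.map (algebraMap ℝ ℂ)) i i'‖
        ≤ θC * Real.exp (-(kap * tdist1 Nf (locΛ i) (locΛ i'))))
    (hdE : ∀ b ∈ V, ∀ σ : TPt d N' → ℂ, (∀ j, σ j ∈ Uσ) →
      ∀ i i', ‖(A b σ - C⁻¹.map (algebraMap ℝ ℂ)) i i'‖ ≤ θE * Real.exp (-(kap * tdist1 Nf (locΛ i) (locΛ i'))))
    (hsmallKθ : K₀ * (m * (1 + 2 / kap) ^ ν) * (θ * (m * (1 + 2 / kap'') ^ ν)) < 1)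
    {cE g : ℝ} (hc0 : 0 ≤ cE) (hc : ∀ k, hC.1.eigenvalues k ≤ cE)
    (hαc : (2 * (θ * (m * (1 + 2 / kap'') ^ ν)) + (γ₂ + a₂₀)) * cE ≤ 1 / 2) (hg : 0 ≤ g)
    (hΓq : ∀ X : Λ ⊕ C₀ → ℝ, (Γ₀ *ᵥ X) ⬝ᵥ (C *ᵥ (Γ₀ *ᵥ X)) ≤ g * (X ⬝ᵥ X))
    (hsmall : (2 * (θ * (m * (1 + 2 / kap'') ^ ν)) + (γ₂ + a₂₀)) * (1 + 2 * cE * g) ≤ 1 / 2)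
    {a a₅ : ℝ} (hPa : a ≤ γ₂ * rP ^ 2)
    (hvol : 2 * (K₀ * (m * (1 + 2 / kap) ^ ν) * (θ * (m * (1 + 2 / kap'') ^ ν))
              * (1 + (1 - K₀ * (m * (1 + 2 / kap) ^ ν) * (θ * (m * (1 + 2 / kap'') ^ ν)))⁻¹) / 2)
          * (Fintype.card Λ : ℝ)
        + w + (2 * (θ * (m * (1 + 2 / kap'') ^ ν)) + (γ₂ + a₂₀)) * cE * (Fintype.card Λ : ℝ)
        + (2 * (θ * (m * (1 + 2 / kap'') ^ ν)) + (γ₂ + a₂₀)) * (1 + 2 * cE * g) * (Fintype.card (Λ ⊕ C₀) : ℝ)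
        ≤ a₅ * ((Z.1).card : ℝ)) :
    DifferentiableOn ℂ
        (fun b => term214 r lZ lD (core214 (A b) (Γ b) (F214 t.2.card χY₀ χcP Dfam (Vk b))) 0 0) V ∧
      ∀ b ∈ V, ‖term214 r lZ lD (core214 (A b) (Γ b) (F214 t.2.card χY₀ χcP Dfam (Vk b))) 0 0‖ ≤
        weight L M c Z a t * Real.exp (a₅ * ((Z.1).card : ℝ)) := by
  refine ⟨?_, fun b hb => ?_⟩
  swap
  · -- (2.26) for the member `b`: H7 at the primitives of `b`
    exact h226_torus_of_primitives_holo_polyτ c hκ₁ hα₆ Z t hpos hhalf hUσ hUτ hUexp hUtau hr hr' hsubτ lZ hlZ lD hlD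
      (A b) (Γ b) χY₀ χcP hχ0 hχc0 Dfam (Vk b) hC Γ₀ (hAhol b hb) hχm hχcm (hVm b hb) (hAs b hb) (hA b hb) (G b)
      (hGhol b hb) (hlin b hb) qP h222 hγ₂ hqP ha0 (h220U b hb) locΛ locN hfibΛ hfibN hkap'' h1 h2 hθE hθΓ hθC hKG
      hKΓ hKCs hK₀ hθEle hθΓle hθR1le (hG b hb) hΓ₀ (hCs b hb) hC216 (hdΓ b hb) (hdC b hb) (hdE b hb) hsmallKθ hc0 hc
      hαc hg hΓq hsmall hPa hvol
  · -- holomorphy in `b` through the corner values (§0, per-domain τ-regions)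
    have hsubσ : ∀ s ∈ Set.uIcc (0 : ℝ) 1, closedBall (s : ℂ) r ⊆ Uσ :=
      fun s hs => (closedBall_subset_closedBall_of_mem_uIcc hr' hs).trans hUexp
    have h0σ : (0 : ℂ) ∈ Uσ := by simpa using hsubσ 0 (by simp) (mem_closedBall_self hr.le)
    have h0τ : ∀ Y, (0 : ℂ) ∈ Uτ Y := fun Y => by simpa using hsubτ Y 0 (by simp) (mem_closedBall_self hr.le)
    refine differentiableOn_term214_param_polyτ hUσ hUτ hr hsubσ hsubτ (V := V)
      (Ψ := fun b σ τ => core214 (A b) (Γ b) (F214 t.2.card χY₀ χcP Dfam (Vk b)) σ τ)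
      (fun b hb τ hτ => ?_) (fun b hb σ hσ => ?_) (fun σ τ hσ hτ => ?_) hlZ.1 hlD.1 (σ₀ := 0) (fun _ => h0σ)
      (τ₀ := 0) (fun Y => h0τ Y)
    · -- the σ-slot at the member `b` (H3), last line at a `τ` of the region
      exact sepHolOn_core214_sigma_of_primitives (weightHyp_tdist1 (N := Nf)) tdist1_symm kc_tdist1 kc_l1_nonneg hUσ
        (A b) (Γ b) (G b) (hAhol b hb) (hGhol b hb) (hAs b hb) (hA b hb) (hlin b hb)
        (F214 t.2.card χY₀ χcP Dfam (Vk b)) τ ((measurable_F214 _ hχm hχcm Dfam (hVm b hb) τ).stronglyMeasurable)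
        (K := Real.exp (-(γ₂ / 2 * rP ^ 2 * (t.2.card : ℕ)) + w)) (a := γ₂ + a₂₀) (Real.exp_pos _).le
        (by positivity)
        (fun Bf => norm_F214_le _ χY₀ χcP Dfam (Vk b) τ qP Bf (hχ0 Bf) (hχc0 Bf) (h222 Bf) hγ₂ (hqP Bf)
          (h220U b hb τ hτ Bf))
        hC Γ₀ locΛ locN hfibΛ hfibN hkap'' h1 h2 hθE hθΓ hθC hKG hKΓ hKCs hK₀ hθEle hθΓle hθR1le (hG b hb) hΓ₀
        (hCs b hb) hC216 (hdΓ b hb) (hdC b hb) (hdE b hb) hsmallKθ hc0 hc hαc hΓq hsmall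
    · -- the τ-slot at the member `b` (poly class on the per-domain regions)
      exact sepHolOnPoly_core214_tau_of_primitives (weightHyp_tdist1 (N := Nf)) tdist1_symm kc_tdist1 kc_l1_nonneg
        hUτ (A b) (Γ b) (G b) σ (hAs b hb σ hσ) (hA b hb σ hσ) (hlin b hb σ hσ)
        t.2.card hχm hχcm hχ0 hχc0 Dfam (hVm b hb) qP h222 hγ₂ hqP ha0 (h220U b hb) hC Γ₀ locΛ locN hfibΛ hfibN
        hkap'' h1 h2 hθE hθΓ hθC hKG hKΓ hKCs hK₀ hθEle hθΓle hθR1le (hG b hb σ hσ) hΓ₀ (hCs b hb σ hσ) hC216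
        (hdΓ b hb σ hσ) (hdC b hb σ hσ) (hdE b hb σ hσ) hsmallKθ hc0 hc hαc hΓq hsmall
    · -- the parameter slot at admissible `(σ, τ)` (§1 over the torus site space)
      show DifferentiableOn ℂ (fun b => cgaussMean (1 : Matrix (Λ ⊕ C₀) (Λ ⊕ C₀) ℂ)
        (integrand214 (A b σ) (Γ b σ) (F214 t.2.card χY₀ χcP Dfam (Vk b) τ))) V
      exact differentiableOn_core214_of_primitives_param (weightHyp_tdist1 (N := Nf)) tdist1_symm kc_tdist1
        kc_l1_nonneg hV (fun b => A b σ) (fun b => Γ b σ) (fun b => G b σ) (hAholb σ hσ) (hGholb σ hσ)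
        (fun b hb => hAs b hb σ hσ) (fun b hb => hA b hb σ hσ) (fun b hb => hlin b hb σ hσ) t.2.card hχm hχcm hχ0
        hχc0 Dfam Vk hVholb hVm τ qP h222 hγ₂ hqP ha0 (fun b hb => h220U b hb τ hτ) hC Γ₀ locΛ locN hfibΛ hfibN
        hkap'' h1 h2 hθE hθΓ hθC hKG hKΓ hKCs hK₀ hθEle hθΓle hθR1le (fun b hb => hG b hb σ hσ) hΓ₀
        (fun b hb => hCs b hb σ hσ) hC216 (fun b hb => hdΓ b hb σ hσ) (fun b hb => hdC b hb σ hσ)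
        (fun b hb => hdE b hb σ hσ) hsmallKθ hc0 hc hαc hΓq hsmall

end Torus

end Summit.QuantumFields.BalabanUV.T4Continuum.Spine.NE5.TwoRunTorusPrimitiveParam

end
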